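import Mathlib

/-!
# Negativity of self-intersection from a Riemann–Roch inequality (solo-informed, T52)

The abstract skeleton of the classical deduction "Riemann–Roch ⟹ Hodge index on the orthogonal
complement of an ample class" (Mattuck–Tate 1958, Grothendieck 1958; Hartshorne V.1.9), in the form in
which Connes–Consani propose to use it for `Spec ℤ × Spec ℤ` (*The Riemann–Roch strategy*,
arXiv:1805.10501, §3.1: "a Riemann–Roch formula whose topological side is `½ D·D` … would make `D` or
`-D` effective for `D·D > 0`, contradicting degree and codegree `0`").

Everything is stated over a real vector space `V` ("divisor classes ⊗ ℝ") with a bilinear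
"intersection" form `I`, an arbitrary real-valued "dimension" function `h0 : V → ℝ` (no integrality, no
linear system is posited) and a class `H`.  The hypotheses are INEQUALITIES only:

* (RR₀)  `h0 D + h0 (-D) ≥ ½ I D D - c`                       (Riemann–Roch, `K = 0` shape), or
  (RR)   `h0 D + h0 (K - D) ≥ ½ I D (D - K) + χ`               (Riemann–Roch with a canonical class),
* (V)    `I D H ≤ 0 → h0 D ≤ B`                                (nothing of non-positive degree is big),
* (S)    `θ ≤ h0 A → θ ≤ h0 A' → h0 A + h0 A' ≤ h0 (A + A') + c`  (multiplying sections; only for (RR)).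

Conclusion (`inter_self_nonpos_of_riemannRoch₀`, `inter_self_nonpos_of_riemannRoch`): `I D H = 0 →
I D D ≤ 0`, by applying the hypotheses to `± m • D` and letting `m → ∞` (`m² δ ≤ O(m)`); and its
Castelnuovo–Severi form on a "product of two curves" (`inter_self_le_two_mul_of_hodge`): if `e₁, e₂`
are isotropic with `I e₁ e₂ = 1` and `H = e₁ + e₂`, then `I Γ Γ ≤ 2 (I Γ e₁) (I Γ e₂)` for every `Γ`.

This file is hypothesis-free mathematics (linear algebra over `ℝ`); its use for the Riemann zeta
function is in `SoloInformedWeilSurface`.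

References: A. Mattuck, J. Tate, Abh. Math. Sem. Hamburg 22 (1958) 295–299; A. Grothendieck,
J. reine angew. Math. 200 (1958) 208–215; R. Hartshorne, *Algebraic Geometry*, V Thm. 1.9, Ex. 1.9;
A. Connes, C. Consani, arXiv:1805.10501, §3.1.
-/

namespace Summit.RiemannHypothesis.RiemannHypothesis.Theorems

variable {V : Type*} [AddCommGroup V] [Module ℝ V]

/-- Scaling of a bilinear form on the diagonal: `I (r • D) (r • D) = r² I D D`. -/
theorem bilin_smul_smul_self (I : LinearMap.BilinForm ℝ V) (r : ℝ) (D : V) :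
    I (r • D) (r • D) = r ^ 2 * I D D := by
  simp only [map_smul, LinearMap.smul_apply, smul_eq_mul]
  ring

/-- **Hodge-type negativity from a `K`-free Riemann–Roch inequality** (the shape of Connes–Consani,
arXiv:1805.10501 §3.1).  If `h0 D + h0 (-D) ≥ ½ I D D - c` for all `D` and `h0` is bounded above by `B`
on `{D : I D H ≤ 0}`, then every `D` with `I D H = 0` has `I D D ≤ 0`:  for `m : ℕ` both `± m • D` are
`H`-orthogonal, so `½ m² I D D - c ≤ 2B`, forcing `I D D ≤ 0`. -/
theorem inter_self_nonpos_of_riemannRoch₀ (I : LinearMap.BilinForm ℝ V) (h0 : V → ℝ) (H : V)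
    (c B : ℝ) (rr : ∀ D, I D D / 2 - c ≤ h0 D + h0 (-D))
    (van : ∀ D, I D H ≤ 0 → h0 D ≤ B) {D : V} (hD : I D H = 0) : I D D ≤ 0 := by
  by_contra hnot
  have hpos : 0 < I D D := lt_of_not_ge hnot
  set δ := I D D with hδ
  -- the bound `m² δ ≤ 4B + 2c` for every natural `m`
  have key : ∀ m : ℕ, (m : ℝ) ^ 2 * δ ≤ 4 * B + 2 * c := by
    intro m
    have h1 := rr ((m : ℝ) • D)
    have hH : I ((m : ℝ) • D) H ≤ 0 := by
      simp only [map_smul, LinearMap.smul_apply, smul_eq_mul, hD, mul_zero, le_refl]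
    have hH' : I (-((m : ℝ) • D)) H ≤ 0 := by
      simp only [map_neg, map_smul, LinearMap.neg_apply, LinearMap.smul_apply, smul_eq_mul, hD,
        mul_zero, neg_zero, le_refl]
    have h2 := van _ hH
    have h3 := van _ hH'
    rw [bilin_smul_smul_self] at h1
    linarith
  -- choose `m` with `m δ > |4B + 2c| + δ`
  obtain ⟨m, hm⟩ := exists_nat_gt ((|4 * B + 2 * c| + δ) / δ)
  have hmδ : |4 * B + 2 * c| + δ < (m : ℝ) * δ := (div_lt_iff₀ hpos).1 hm
  have hm0 : (0 : ℝ) ≤ m := Nat.cast_nonneg m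
  have hm1 : (1 : ℝ) ≤ m := by
    by_contra h
    have h' : (m : ℝ) < 1 := lt_of_not_ge h
    have : (m : ℝ) * δ ≤ 1 * δ := mul_le_mul_of_nonneg_right h'.le hpos.le
    linarith [abs_nonneg (4 * B + 2 * c)]
  have hsq : (m : ℝ) * δ ≤ (m : ℝ) ^ 2 * δ := by
    rw [sq]
    exact mul_le_mul_of_nonneg_right (le_mul_of_one_le_left hm0 hm1) hpos.le
  linarith [key m, le_abs_self (4 * B + 2 * c)]

/-- **Hodge-type negativity from Riemann–Roch with a canonical class** (the shape of Mattuck–Tate 1958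
/ Grothendieck 1958, Hartshorne V.1.9): Riemann–Roch `h0 D + h0 (K - D) ≥ ½ I D (D - K) + χ`,
boundedness of `h0` on `{I D H ≤ 0}`, and super-additivity of `h0` up to a constant on pairs of "big"
classes (`h0 ≥ θ`; from multiplying sections) imply `I D H = 0 → I D D ≤ 0`.  Proof: Riemann–Roch at
`± m • D` makes `h0 (K ∓ m • D) ≥ ½ m² I D D + O(m)`, and super-additivity bounds their sum by
`h0 (K + K) + c`. -/
theorem inter_self_nonpos_of_riemannRoch (I : LinearMap.BilinForm ℝ V) (h0 : V → ℝ) (H K : V)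
    (χ B θ c : ℝ) (rr : ∀ D, I D (D - K) / 2 + χ ≤ h0 D + h0 (K - D))
    (van : ∀ D, I D H ≤ 0 → h0 D ≤ B)
    (sadd : ∀ A A', θ ≤ h0 A → θ ≤ h0 A' → h0 A + h0 A' ≤ h0 (A + A') + c)
    {D : V} (hD : I D H = 0) : I D D ≤ 0 := by
  by_contra hnot
  have hpos : 0 < I D D := lt_of_not_ge hnot
  set δ := I D D with hδ
  set s := I D K with hs
  -- Riemann–Roch at `± m • D`
  have lower : ∀ m : ℕ, ((m : ℝ) ^ 2 * δ - m * s) / 2 + χ - B ≤ h0 (K - (m : ℝ) • D) ∧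
      ((m : ℝ) ^ 2 * δ + m * s) / 2 + χ - B ≤ h0 (K + (m : ℝ) • D) := by
    intro m
    have h1 := rr ((m : ℝ) • D)
    have h2 := rr (-((m : ℝ) • D))
    have hH : I ((m : ℝ) • D) H ≤ 0 := by
      simp only [map_smul, LinearMap.smul_apply, smul_eq_mul, hD, mul_zero, le_refl]
    have hH' : I (-((m : ℝ) • D)) H ≤ 0 := by
      simp only [map_neg, map_smul, LinearMap.neg_apply, LinearMap.smul_apply, smul_eq_mul, hD,
        mul_zero, neg_zero, le_refl]
    have h3 := van _ hH
    have h4 := van _ hH'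
    have e1 : I ((m : ℝ) • D) ((m : ℝ) • D - K) = (m : ℝ) ^ 2 * δ - m * s := by
      simp only [map_sub, map_smul, LinearMap.smul_apply, smul_eq_mul]
      ring
    have e2 : I (-((m : ℝ) • D)) (-((m : ℝ) • D) - K) = (m : ℝ) ^ 2 * δ + m * s := by
      simp only [map_sub, map_neg, map_smul, LinearMap.smul_apply, LinearMap.neg_apply, smul_eq_mul]
      ring
    have e3 : K - -((m : ℝ) • D) = K + (m : ℝ) • D := sub_neg_eq_add K _
    rw [e1] at h1
    rw [e2, e3] at h2
    exact ⟨by linarith, by linarith⟩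
  -- a natural number beyond every threshold
  set T := |s| + 2 * |θ| + 2 * |χ| + 2 * |B| + |h0 (K + K)| + |c| with hT
  have hT0 : 0 ≤ T := by positivity
  obtain ⟨m, hm⟩ := exists_nat_gt ((T + δ) / δ)
  have hmδ : T + δ < (m : ℝ) * δ := (div_lt_iff₀ hpos).1 hm
  have hm0 : (0 : ℝ) ≤ m := Nat.cast_nonneg m
  have hm1 : (1 : ℝ) ≤ m := by
    by_contra h
    have h' : (m : ℝ) < 1 := lt_of_not_ge h
    have : (m : ℝ) * δ ≤ 1 * δ := mul_le_mul_of_nonneg_right h'.le hpos.le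
    linarith
  obtain ⟨hA, hA'⟩ := lower m
  -- both `h0 (K ∓ m D)` exceed the threshold `θ`
  have hbig : 2 * |θ| + 2 * |χ| + 2 * |B| ≤ (m : ℝ) * ((m : ℝ) * δ - |s|) := by
    have h1 : 2 * |θ| + 2 * |χ| + 2 * |B| ≤ (m : ℝ) * δ - |s| := by
      linarith [abs_nonneg (h0 (K + K)), abs_nonneg c]
    have h2 : 0 ≤ (m : ℝ) * δ - |s| := by linarith [abs_nonneg θ, abs_nonneg χ, abs_nonneg B]
    nlinarith
  have hms : -((m : ℝ) * |s|) ≤ (m : ℝ) * s ∧ (m : ℝ) * s ≤ (m : ℝ) * |s| := by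
    constructor
    · nlinarith [neg_abs_le s]
    · nlinarith [le_abs_self s]
  have hθA : θ ≤ h0 (K - (m : ℝ) • D) := by
    have : 2 * θ - 2 * χ + 2 * B ≤ (m : ℝ) ^ 2 * δ - m * s := by
      nlinarith [le_abs_self θ, neg_abs_le χ, le_abs_self B, hms.2]
    linarith
  have hθA' : θ ≤ h0 (K + (m : ℝ) • D) := by
    have : 2 * θ - 2 * χ + 2 * B ≤ (m : ℝ) ^ 2 * δ + m * s := by
      nlinarith [le_abs_self θ, neg_abs_le χ, le_abs_self B, hms.1]
    linarith
  have hsum := sadd _ _ hθA hθA'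
  have e4 : K - (m : ℝ) • D + (K + (m : ℝ) • D) = K + K := by abel
  rw [e4] at hsum
  -- `m² δ + 2χ - 2B ≤ h0 (2K) + c`, impossible for `m δ > T + δ`
  have hsq : (m : ℝ) * δ ≤ (m : ℝ) ^ 2 * δ := by
    rw [sq]
    exact mul_le_mul_of_nonneg_right (le_mul_of_one_le_left hm0 hm1) hpos.le
  linarith [le_abs_self (h0 (K + K)), le_abs_self c, neg_abs_le χ, le_abs_self B, abs_nonneg s,
    abs_nonneg θ]

/-- **Castelnuovo–Severi form** (Weil 1940/48; Hartshorne V Ex. 1.9): if `e₁, e₂` are isotropic classes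
with `I e₁ e₂ = 1` and the negativity `I D (e₁ + e₂) = 0 → I D D ≤ 0` holds, then for every `Γ`,
`I Γ Γ ≤ 2 (I Γ e₁) (I Γ e₂)` — apply negativity to `Γ - (I Γ e₂) • e₁ - (I Γ e₁) • e₂`. -/
theorem inter_self_le_two_mul_of_hodge (I : LinearMap.BilinForm ℝ V) (hI : ∀ x y, I x y = I y x)
    {e₁ e₂ : V} (h₁ : I e₁ e₁ = 0) (h₂ : I e₂ e₂ = 0) (h₁₂ : I e₁ e₂ = 1)
    (hodge : ∀ D, I D (e₁ + e₂) = 0 → I D D ≤ 0) (Γ : V) :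
    I Γ Γ ≤ 2 * I Γ e₁ * I Γ e₂ := by
  have h₂₁ : I e₂ e₁ = 1 := by rw [hI, h₁₂]
  have hs₁ : I e₁ Γ = I Γ e₁ := hI _ _
  have hs₂ : I e₂ Γ = I Γ e₂ := hI _ _
  have h := hodge (Γ - I Γ e₂ • e₁ - I Γ e₁ • e₂) (by
    simp only [map_sub, map_add, map_smul, LinearMap.sub_apply, LinearMap.smul_apply, smul_eq_mul,
      h₁, h₂, h₁₂, h₂₁]
    ring)
  simp only [map_sub, map_smul, LinearMap.sub_apply, LinearMap.smul_apply, smul_eq_mul, h₁, h₂,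
    h₁₂, h₂₁, hs₁, hs₂] at h
  nlinarith [h]

end Summit.RiemannHypothesis.RiemannHypothesis.Theorems
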